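import Summits.ResolutionOfSingularities.ResolutionOfSingularities.Theorems.EquisingularLiftEquisingularLiftNatExactShadowRegularCentres
import Literature.AlgebraicGeometry.Resolution.SurfaceResolutionPermissibleCentres
import Literature.AlgebraicGeometry.Resolution.ProjectiveSpaceExcellent
import Literature.AlgebraicGeometry.Resolution.ExcellentClosedSubschemes
import Literature.AlgebraicGeometry.Resolution.PointBlowupHsFunMono
import HarnessLib

/-!
# [OURS · L1 W4.5(b) · EL♮] T-EXACT-SHADOW fed by COSSART–JANNSEN–SAITO Thm. 1.2 (permissible centres): «CJS + exact lifts ⇒ EL♮»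
# (res-L1-w45b-lead-2's TARGET (6) 2026-08-27T07:06:48Z, file 4 — «for surfaces the hypothesis is CJS + nothing [+ the lifts]»)

Crux `EquisingularLiftNat` = stmt-ResolutionOfSingularities-20038 (route EquisingularLift), line `sections`; helper file
`--supports … --as helper` by res-D-pv-037. HONEST FRAMING: OURS (cell res-hironaka, slot W4.5(b)); NOT a statement of any manuscript;
a CONDITIONAL rung: conditional on the Literature NAMED FACT `CossartJannsenSaito2020SequencePermissible` (Cossart–Jannsen–Saito,
LNM 2270, Thm. 1.2 as printed, typed in `Literature/…/Resolution/SurfaceResolutionPermissibleCentres.lean`, unproved in the tree),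
on the exact-lift hypothesis `(MS)` (explicit binder) and on `topologicalKrullDim H ≤ 2` (explicit binder; automatic for
hypersurfaces of `ℙ³`, not derived here). AI-written, weaker than expert review. No `sorry`; standard axioms.

* `isRegular_subscheme_of_isPermissible` — a permissible centre (CJS Def. 3.1 (2)) is a regular scheme
  (`Ideal.IsPermissible.isRegularLocalRing` + `isRegularLocalRing_stalk_subscheme_iff`).
* `reaches_of_centreSeq` — a `CentreSeq X` (blow-up sequence AS DATA) with all centres permissible and inside the singular loci
  of their stages implies the `(DOWN)` closure clause of file 3 (`Adm := «V(D) regular»`) from `X` to its last scheme `s.top`.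
* `elNatOver_of_CJSPermissible` / `elNatAt_of_CJSPermissible` — `H ⊆ ℙⁿ_k` integral with `topologicalKrullDim H ≤ 2` (so `H` is a
  reduced excellent Noetherian scheme of dimension `≤ 2`: `isNoetherian_of_isClosedImmersion`, `IsExcellent.of_isClosedImmersion`,
  `ProjectiveSpace.isExcellent_projectiveSpace`); `CossartJannsenSaito2020SequencePermissible` supplies the downstairs resolution
  by blow-ups at permissible (hence regular) centres inside the singular loci; `(MS)` = exact admissible lifts of regular centres at
  every horizontal-E1 stage ⇒ `Theorems.EquisingularLift.ELNatOver p k n H ι O π` (`elNatOver_of_regularCentreSequence`, file 3).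

References: …NatExactShadowRegularCentres.lean (p511733), …NatExactShadowELNat.lean (p510833), …NatExactShadow.lean (p509671);
Literature/…/Resolution/SurfaceResolutionPermissibleCentres.lean, PermissibleCentres.lean, BlowupSequences.lean (`CentreSeq`),
ProjectiveSpaceExcellent.lean, ExcellentClosedSubschemes.lean, PointBlowupHsFunMono.lean; Cossart–Jannsen–Saito LNM 2270 Thm. 1.2,
Def. 3.1; L/w45b/CHAIN.md v7.2; LEAD-MEMO-2 §8.
-/

set_option linter.dupNamespace false -- mandated namespace `Summit.<Summit>.<Problem>` of this single-conjunct summit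
set_option linter.overlappingInstances false -- signatures carry `[IsDomain O] [IsDiscreteValuationRing O]`

noncomputable section

open CategoryTheory CategoryTheory.Limits AlgebraicGeometry TopologicalSpace Topology
open MvPolynomial HomogeneousIdeal
open Literature.AlgebraicGeometry.Resolution
open AlgebraicGeometry.Scheme.IdealSheafData
open Summit.ResolutionOfSingularities.ResolutionOfSingularities.Theses.EquisingularLift.Split
open Summit.ResolutionOfSingularities.ResolutionOfSingularities.Cruxes.EquisingularLift.StrataSplit

namespace Summit.ResolutionOfSingularities.ResolutionOfSingularities.Cruxes.EquisingularLiftNat.Sections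

universe u

/-- **A permissible centre is a regular scheme**: if `V(C) ⊂ X` is permissible (CJS Def. 3.1 (2): at every point of `V(C)` the
quotient `𝒪_{X,x}/C_x` is regular, `X` is normally flat along `V(C)`, no component inside), then the scheme `V(C)` is regular.
[cite: CossartJannsenSaito2020, Def. 3.1 (2)] -/
theorem isRegular_subscheme_of_isPermissible {X : Scheme.{u}} (C : X.IdealSheafData)
    (h : IdealSheafData.IsPermissible C) : Scheme.IsRegular C.subscheme := by
  intro s
  have hs : (C.subschemeι.base s) ∈ C.support := by
    have : (C.subschemeι s : X) ∈ Set.range C.subschemeι := Set.mem_range_self s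
    rw [Scheme.IdealSheafData.range_subschemeι] at this
    exact this
  rw [isRegularLocalRing_stalk_subscheme_iff C s]
  exact (h _ hs).isRegularLocalRing

/-- **A permissible blow-up sequence with centres in the singular loci reaches its last scheme in the `(DOWN)` closure**: for
`s : CentreSeq X` with all centres permissible and stagewise inside the singular locus, every predicate of schemes holding at
`X` and stable under blow-ups along ideal sheaves `D` with `V(D)` regular and `supp D ⊆ Sing` holds at `s.top`.
[cite: CossartJannsenSaito2020, Thm. 1.2 (p. 5)] -/
theorem reaches_of_centreSeq : ∀ {X : Scheme.{u}} (s : CentreSeq X), s.AllPermissible → s.CentresInSingularLocus →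
    ∀ R : Scheme.{u} → Prop, R X →
      (∀ (Γ₁ Γ₂ : Scheme.{u}) (D : Γ₁.IdealSheafData) (υ : Γ₂ ⟶ Γ₁), R Γ₁ →
        (D.support : Set Γ₁) ⊆ (Scheme.regularLocus Γ₁)ᶜ → Scheme.IsRegular D.subscheme → IsBlowup υ D → R Γ₂) →
      R s.top
  | _, CentreSeq.nil _, _, _, _, h0, _ => h0
  | _, CentreSeq.cons C rest, hperm, hsing, R, h0, hs =>
    reaches_of_centreSeq rest hperm.2 hsing.2 R
      (hs _ _ C (blowup.π C) h0 hsing.1 (isRegular_subscheme_of_isPermissible C hperm.1) (blowup.isBlowup C)) hs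

/-- **COSSART–JANNSEN–SAITO + EXACT ADMISSIBLE LIFTS ⇒ `ELNatOver`** (see the module docstring). Conditional on the named fact
`CossartJannsenSaito2020SequencePermissible` (CJS Thm. 1.2 as printed). For `H ⊆ ℙⁿ_k` integral of dimension `≤ 2` and a
characteristic-0 DVR `O` with `π : O ↠ k`: if at every horizontal-E1 stage over `ℙⁿ_O` every ideal sheaf `D` of the reduced
strict transform with `V(D)` regular and `supp D ⊆ Sing` has an exact admissible lift, then EL♮ holds for `H` over `(O, π)`.
[cite: CossartJannsenSaito2020, Thm. 1.2 (p. 5)] -/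
theorem elNatOver_of_CJSPermissible (hCJS : CossartJannsenSaito2020SequencePermissible.{0})
    {p : ℕ} (k : Type) [Field k] [CharP k p] [IsAlgClosed k] (n : ℕ)
    (H : Scheme.{0}) (ι : H ⟶ (Literature.AlgebraicGeometry.Motives.projectiveSpace n k).left) [IsClosedImmersion ι]
    [IsIntegral H] (hdim : topologicalKrullDim H ≤ 2)
    (O : Type) [CommRing O] [IsDomain O] [IsDiscreteValuationRing O] [CharZero O] (π : O →+* k)
    (hπ : Function.Surjective π)
    (hMS : letI := MvPolynomial.gradedAlgebra (σ := Fin (n + 1)) (R := O);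
      letI := MvPolynomial.gradedAlgebra (σ := Fin (n + 1)) (R := k);
      ∀ (φ : homogeneousSubmodule (Fin (n + 1)) O →+*ᵍ homogeneousSubmodule (Fin (n + 1)) k)
        (hφ' : HomogeneousIdeal.irrelevant (homogeneousSubmodule (Fin (n + 1)) k) ≤
          (HomogeneousIdeal.irrelevant (homogeneousSubmodule (Fin (n + 1)) O)).map φ),
        (∀ s, φ s = MvPolynomial.map π s) →
      ∀ (X₁ : Scheme.{0}) (σ₁ : X₁ ⟶ Proj (homogeneousSubmodule (Fin (n + 1)) O)) (S₁ : Set X₁),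
        (∀ Q : (∀ X' : Scheme.{0}, (X' ⟶ Proj (homogeneousSubmodule (Fin (n + 1)) O)) → Set X' → Prop),
          Q (Proj (homogeneousSubmodule (Fin (n + 1)) O)) (𝟙 _) (Set.range (ι ≫ Proj.map φ hφ')) →
          (∀ (X' X'' : Scheme.{0}) (σ' : X' ⟶ Proj (homogeneousSubmodule (Fin (n + 1)) O)) (Y' : Set X')
            (C : X'.IdealSheafData) (τ : X'' ⟶ X'), Q X' σ' Y' → IsBlowup τ C → Scheme.IsRegular C.subscheme →
            Flat (C.subschemeι ≫ σ' ≫ Proj.toSpecZero (homogeneousSubmodule (Fin (n + 1)) O) ≫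
              Spec.map (CommRingCat.ofHom (algebraMap O (homogeneousSubmodule (Fin (n + 1)) O 0)))) →
            σ' '' (C.support : Set X') ⊆ {x | ¬ IsGenericPoint x (Set.range (ι ≫ Proj.map φ hφ'))} →
            (C.support : Set X') ∩ (σ' ≫ Proj.toSpecZero (homogeneousSubmodule (Fin (n + 1)) O) ≫
              Spec.map (CommRingCat.ofHom (algebraMap O (homogeneousSubmodule (Fin (n + 1)) O 0)))) ⁻¹'
              {IsLocalRing.closedPoint O} ⊆ Y' →
            Q X'' (τ ≫ σ') (closure (τ ⁻¹' (Y' \ (C.support : Set X'))))) → Q X₁ σ₁ S₁) →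
        IsLocallyNoetherian X₁ → Scheme.IsRegular X₁ →
        IsProper (σ₁ ≫ Proj.toSpecZero (homogeneousSubmodule (Fin (n + 1)) O) ≫
          Spec.map (CommRingCat.ofHom (algebraMap O (homogeneousSubmodule (Fin (n + 1)) O 0)))) →
        IsClosed S₁ → IsIrreducible S₁ →
        S₁ ⊆ (σ₁ ≫ Proj.toSpecZero (homogeneousSubmodule (Fin (n + 1)) O) ≫
          Spec.map (CommRingCat.ofHom (algebraMap O (homogeneousSubmodule (Fin (n + 1)) O 0)))) ⁻¹'
          {IsLocalRing.closedPoint O} →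
        ∀ D : ((vanishingIdeal (⟨closure S₁, isClosed_closure⟩ : Closeds X₁)).subscheme).IdealSheafData,
          (D.support : Set ↥(vanishingIdeal (⟨closure S₁, isClosed_closure⟩ : Closeds X₁)).subscheme) ⊆
            (Scheme.regularLocus (vanishingIdeal (⟨closure S₁, isClosed_closure⟩ : Closeds X₁)).subscheme)ᶜ →
          Scheme.IsRegular D.subscheme →
          ∃ C : X₁.IdealSheafData, Scheme.IsRegular C.subscheme ∧
            Flat (C.subschemeι ≫ σ₁ ≫ Proj.toSpecZero (homogeneousSubmodule (Fin (n + 1)) O) ≫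
              Spec.map (CommRingCat.ofHom (algebraMap O (homogeneousSubmodule (Fin (n + 1)) O 0)))) ∧
            (C.support : Set X₁) ∩ (σ₁ ≫ Proj.toSpecZero (homogeneousSubmodule (Fin (n + 1)) O) ≫
              Spec.map (CommRingCat.ofHom (algebraMap O (homogeneousSubmodule (Fin (n + 1)) O 0)))) ⁻¹'
              {IsLocalRing.closedPoint O} ⊆ S₁ ∧
            C.comap (vanishingIdeal (⟨closure S₁, isClosed_closure⟩ : Closeds X₁)).subschemeι = D) :
    Theorems.EquisingularLift.ELNatOver p k n H ι O π := by
  -- `H` is a reduced excellent Noetherian scheme of dimension `≤ 2`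
  haveI : IsNoetherian (Literature.AlgebraicGeometry.Motives.projectiveSpace n k).left :=
    ProjectiveSpace.isNoetherian_projectiveSpace n k
  haveI : IsNoetherian H := isNoetherian_of_isClosedImmersion ι
  have hexc : Scheme.IsExcellent H :=
    (ProjectiveSpace.isExcellent_projectiveSpace n k).of_isClosedImmersion ι
  -- CJS Thm. 1.2: a permissible blow-up sequence with centres in the singular loci and regular last scheme
  obtain ⟨s, hperm, hsing, hreg⟩ := hCJS H hexc hdim
  exact elNatOver_of_regularCentreSequence k n H ι O π hπ
    ⟨s.top, fun R h0 hs => reaches_of_centreSeq s hperm hsing R h0 hs, hreg⟩ hMS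

/-- **COSSART–JANNSEN–SAITO + EXACT ADMISSIBLE LIFTS ⇒ `ELNatAt`** — the same packaged with `elNatAt_of_elNatOver`.
[cite: CossartJannsenSaito2020, Thm. 1.2 (p. 5)] -/
theorem elNatAt_of_CJSPermissible (hCJS : CossartJannsenSaito2020SequencePermissible.{0})
    {p : ℕ} (k : Type) [Field k] [CharP k p] [IsAlgClosed k] (n : ℕ)
    (H : Scheme.{0}) (ι : H ⟶ (Literature.AlgebraicGeometry.Motives.projectiveSpace n k).left) [IsClosedImmersion ι]
    [IsIntegral H] (hdim : topologicalKrullDim H ≤ 2)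
    (O : Type) [CommRing O] [IsDomain O] [IsDiscreteValuationRing O] [CharZero O] (π : O →+* k)
    (hπ : Function.Surjective π)
    (hMS : letI := MvPolynomial.gradedAlgebra (σ := Fin (n + 1)) (R := O);
      letI := MvPolynomial.gradedAlgebra (σ := Fin (n + 1)) (R := k);
      ∀ (φ : homogeneousSubmodule (Fin (n + 1)) O →+*ᵍ homogeneousSubmodule (Fin (n + 1)) k)
        (hφ' : HomogeneousIdeal.irrelevant (homogeneousSubmodule (Fin (n + 1)) k) ≤
          (HomogeneousIdeal.irrelevant (homogeneousSubmodule (Fin (n + 1)) O)).map φ),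
        (∀ s, φ s = MvPolynomial.map π s) →
      ∀ (X₁ : Scheme.{0}) (σ₁ : X₁ ⟶ Proj (homogeneousSubmodule (Fin (n + 1)) O)) (S₁ : Set X₁),
        (∀ Q : (∀ X' : Scheme.{0}, (X' ⟶ Proj (homogeneousSubmodule (Fin (n + 1)) O)) → Set X' → Prop),
          Q (Proj (homogeneousSubmodule (Fin (n + 1)) O)) (𝟙 _) (Set.range (ι ≫ Proj.map φ hφ')) →
          (∀ (X' X'' : Scheme.{0}) (σ' : X' ⟶ Proj (homogeneousSubmodule (Fin (n + 1)) O)) (Y' : Set X')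
            (C : X'.IdealSheafData) (τ : X'' ⟶ X'), Q X' σ' Y' → IsBlowup τ C → Scheme.IsRegular C.subscheme →
            Flat (C.subschemeι ≫ σ' ≫ Proj.toSpecZero (homogeneousSubmodule (Fin (n + 1)) O) ≫
              Spec.map (CommRingCat.ofHom (algebraMap O (homogeneousSubmodule (Fin (n + 1)) O 0)))) →
            σ' '' (C.support : Set X') ⊆ {x | ¬ IsGenericPoint x (Set.range (ι ≫ Proj.map φ hφ'))} →
            (C.support : Set X') ∩ (σ' ≫ Proj.toSpecZero (homogeneousSubmodule (Fin (n + 1)) O) ≫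
              Spec.map (CommRingCat.ofHom (algebraMap O (homogeneousSubmodule (Fin (n + 1)) O 0)))) ⁻¹'
              {IsLocalRing.closedPoint O} ⊆ Y' →
            Q X'' (τ ≫ σ') (closure (τ ⁻¹' (Y' \ (C.support : Set X'))))) → Q X₁ σ₁ S₁) →
        IsLocallyNoetherian X₁ → Scheme.IsRegular X₁ →
        IsProper (σ₁ ≫ Proj.toSpecZero (homogeneousSubmodule (Fin (n + 1)) O) ≫
          Spec.map (CommRingCat.ofHom (algebraMap O (homogeneousSubmodule (Fin (n + 1)) O 0)))) →
        IsClosed S₁ → IsIrreducible S₁ →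
        S₁ ⊆ (σ₁ ≫ Proj.toSpecZero (homogeneousSubmodule (Fin (n + 1)) O) ≫
          Spec.map (CommRingCat.ofHom (algebraMap O (homogeneousSubmodule (Fin (n + 1)) O 0)))) ⁻¹'
          {IsLocalRing.closedPoint O} →
        ∀ D : ((vanishingIdeal (⟨closure S₁, isClosed_closure⟩ : Closeds X₁)).subscheme).IdealSheafData,
          (D.support : Set ↥(vanishingIdeal (⟨closure S₁, isClosed_closure⟩ : Closeds X₁)).subscheme) ⊆
            (Scheme.regularLocus (vanishingIdeal (⟨closure S₁, isClosed_closure⟩ : Closeds X₁)).subscheme)ᶜ →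
          Scheme.IsRegular D.subscheme →
          ∃ C : X₁.IdealSheafData, Scheme.IsRegular C.subscheme ∧
            Flat (C.subschemeι ≫ σ₁ ≫ Proj.toSpecZero (homogeneousSubmodule (Fin (n + 1)) O) ≫
              Spec.map (CommRingCat.ofHom (algebraMap O (homogeneousSubmodule (Fin (n + 1)) O 0)))) ∧
            (C.support : Set X₁) ∩ (σ₁ ≫ Proj.toSpecZero (homogeneousSubmodule (Fin (n + 1)) O) ≫
              Spec.map (CommRingCat.ofHom (algebraMap O (homogeneousSubmodule (Fin (n + 1)) O 0)))) ⁻¹'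
              {IsLocalRing.closedPoint O} ⊆ S₁ ∧
            C.comap (vanishingIdeal (⟨closure S₁, isClosed_closure⟩ : Closeds X₁)).subschemeι = D) :
    Theorems.EquisingularLift.ELNatAt p k n H ι :=
  Theorems.EquisingularLift.elNatAt_of_elNatOver hπ
    (elNatOver_of_CJSPermissible hCJS k n H ι hdim O π hπ hMS)

end Summit.ResolutionOfSingularities.ResolutionOfSingularities.Cruxes.EquisingularLiftNat.Sections

end
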